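import Literature.Probability.Process.MartingaleIncrementsChebyshev
import HarnessLib

/-!
# `TransferActivityTails` (stmt-AtomisticToContinuum-16624), line `Sketch` (predictor-drift-doob): stub `stub_driftLLNEngine`

The abstract "drift ⇒ LLN" engine of the line, pure probability.  Blocks `X_0, …, X_{K-1} ≥ 0` on a probability
space; the one-step predictor of `X_{j+1}` given the history obeys, in integrated form against `[0,1]`-valued
measurable test functionals `g` of `(X_0, …, X_j)`, the drift `E[X_{j+1} g] ≤ E[(ρ · L⁻¹ Σ_{k<L} X_{j+1-L+k} + C) g]`
(`L ≤ j + 1 < K`).  With `ā := K⁻¹ Σ_{j<K} X_j` and `V₀ := 4(C+1)/(1-ρ)` the conclusion is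
`E[ā 𝟙{ā > V₀}] ≤ M'(δ + (M² + L m)/K) + δ'`, where `Σ_j E(X_j - M)₊ ≤ Kδ`, `Σ_j E(X_j - M')₊ ≤ Kδ'`,
`Σ_{j<L} E X_j ≤ L m`.

Proof (Doob decomposition along the natural filtration `σ(X_{<n}) = comap (ω ↦ (X_k ω)_{k<n})`): truncate
`Y_n := min X_n M`, predictors `π_n := P[Y_n | σ(X_{<n})]`, increments `D_n := Y_n - π_n`; the drift hypothesis
tested on indicators of past events gives `π_n ≤ ρ H_n + C` a.e. (`condExp_trunc_ae_le`); bounded increments are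
orthogonal so `P{Σ D_n > K} ≤ M²/K` (Chebyshev, `Literature.Probability.Process.meas_sum_increments_le`); Markov
bounds the first `L` blocks and the overshoots; the pathwise inequality `(1-ρ) K ā ≤ A + B + C K + S`
(`sum_Ico_window_le`: each block lies in at most `L` windows) yields `{ā > V₀} ⊆ {A > K} ∪ {B > K} ∪ {S > K}` a.e.
(`lt_or_lt_or_lt_of_drift`); finally `ā 𝟙{ā > V₀} ≤ K⁻¹ Σ_j (X_j - M')₊ + M' 𝟙{ā > V₀}`.  The generic martingale
lemmas live in `Literature/Probability/Process/MartingaleIncrementsChebyshev.lean`.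
-/

noncomputable section

open MeasureTheory Set Filter
open scoped ENNReal BigOperators

namespace Summit.AtomisticToContinuum.HydrodynamicLimit.Theorems.TransferActivityTailsDriftLLNEngine

open Literature.Probability.Process

/-- Sliding windows: each index `j < K` lies in at most `L` of the windows `{n - L, …, n - 1}`, `L ≤ n < K`, so for
a nonnegative sequence `Σ_{n=L}^{K-1} L⁻¹ Σ_{k<L} x (n - L + k) ≤ Σ_{j<K} x j`. -/
theorem sum_Ico_window_le (x : ℕ → ℝ) (hx : ∀ j, 0 ≤ x j) {K L : ℕ} (hL : 1 ≤ L) (hLK : L ≤ K) :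
    ∑ n ∈ Finset.Ico L K, (L : ℝ)⁻¹ * ∑ k ∈ Finset.range L, x (n - L + k) ≤
      ∑ j ∈ Finset.range K, x j := by
  have hL0 : (L : ℝ) ≠ 0 := by exact_mod_cast (by omega : L ≠ 0)
  have hwin : ∀ k ∈ Finset.range L,
      ∑ n ∈ Finset.Ico L K, x (n - L + k) ≤ ∑ j ∈ Finset.range K, x j := by
    intro k hk
    rw [Finset.mem_range] at hk
    rw [Finset.sum_Ico_eq_sum_range]
    have e : ∀ i ∈ Finset.range (K - L), x (L + i - L + k) = x (k + i) := fun i _ => by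
      congr 1
      omega
    have e2 : ∑ i ∈ Finset.range (K - L), x (k + i) = ∑ j ∈ Finset.Ico k (k + (K - L)), x j := by
      rw [Finset.sum_Ico_eq_sum_range, Nat.add_sub_cancel_left]
    rw [Finset.sum_congr rfl e, e2]
    refine Finset.sum_le_sum_of_subset_of_nonneg (fun j hj => ?_) fun j _ _ => hx j
    simp only [Finset.mem_Ico, Finset.mem_range] at hj ⊢
    omega
  calc ∑ n ∈ Finset.Ico L K, (L : ℝ)⁻¹ * ∑ k ∈ Finset.range L, x (n - L + k)
      = (L : ℝ)⁻¹ * ∑ k ∈ Finset.range L, ∑ n ∈ Finset.Ico L K, x (n - L + k) := by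
        rw [← Finset.mul_sum, Finset.sum_comm]
    _ ≤ (L : ℝ)⁻¹ * ∑ k ∈ Finset.range L, ∑ j ∈ Finset.range K, x j := by
        gcongr with k hk
        exact hwin k hk
    _ = ∑ j ∈ Finset.range K, x j := by
        rw [Finset.sum_const, Finset.card_range, nsmul_eq_mul, ← mul_assoc, inv_mul_cancel₀ hL0,
          one_mul]


/-- Elementary trichotomy behind the union bound: if `(1 - ρ) T ≤ A + B + C K + S` and the average `K⁻¹ T`
exceeds `4 (C + 1) / (1 - ρ)`, then one of `A`, `B`, `S` exceeds `K`. -/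
theorem lt_or_lt_or_lt_of_drift {T A B S ρ C K : ℝ} (hρ1 : ρ < 1) (hC : 0 ≤ C) (hK : 0 < K)
    (hT : (1 - ρ) * T ≤ A + B + C * K + S) (hV : 4 * (C + 1) / (1 - ρ) < K⁻¹ * T) :
    K < A ∨ K < B ∨ K < S := by
  rcases lt_or_ge K A with hA | hA
  · exact Or.inl hA
  rcases lt_or_ge K B with hB | hB
  · exact Or.inr (Or.inl hB)
  rcases lt_or_ge K S with hS | hS
  · exact Or.inr (Or.inr hS)
  exfalso
  have hρ' : 0 < 1 - ρ := by linarith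
  have h1 : (1 - ρ) * T ≤ (C + 3) * K := by linarith
  rw [div_lt_iff₀ hρ'] at hV
  have h2 : K⁻¹ * T * (1 - ρ) ≤ C + 3 := by
    calc K⁻¹ * T * (1 - ρ) = K⁻¹ * ((1 - ρ) * T) := by ring
      _ ≤ K⁻¹ * ((C + 3) * K) := mul_le_mul_of_nonneg_left h1 (inv_nonneg.2 hK.le)
      _ = C + 3 := by field_simp
  linarith

/-- The integrated one-step drift hypothesis, tested against indicators of events of the past
`σ(X_0, …, X_{n-1}) = comap (ω ↦ (X k ω)_{k<n})`, bounds the predictor of the truncated block a.e.: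
`P[min (X n) M | σ(X_{<n})] ≤ ρ · L⁻¹ Σ_{k<L} X (n-L+k) + C`. -/
theorem condExp_trunc_ae_le {Ω : Type*} {mΩ : MeasurableSpace Ω} {P : Measure Ω}
    [IsProbabilityMeasure P] (X : ℕ → Ω → ℝ) (hXm : ∀ j, Measurable (X j)) (hX0 : ∀ j ω, 0 ≤ X j ω)
    {ρ C : ℝ} (M : ℝ) (hρ0 : 0 ≤ ρ) (hC : 0 ≤ C) {L n : ℕ} (hLn : L ≤ n)
    (hint : ∀ j ≤ n, Integrable (X j) P)
    (hdrift : ∀ g : (Fin n → ℝ) → ℝ, Measurable g → (∀ y, 0 ≤ g y ∧ g y ≤ 1) →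
      ∫⁻ ω, ENNReal.ofReal (X n ω * g (fun k => X k ω)) ∂P ≤
      ∫⁻ ω, ENNReal.ofReal ((ρ * ((L : ℝ)⁻¹ * ∑ k ∈ Finset.range L, X (n - L + k) ω) + C) *
        g (fun k => X k ω)) ∂P) :
    P[fun ω => min (X n ω) M | MeasurableSpace.comap (fun ω (k : Fin n) => X k ω) inferInstance]
      ≤ᵐ[P] fun ω => ρ * ((L : ℝ)⁻¹ * ∑ k ∈ Finset.range L, X (n - L + k) ω) + C := by
  have hpm : Measurable fun ω (k : Fin n) => X k ω := measurable_pi_lambda _ fun k => hXm k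
  have hm : MeasurableSpace.comap (fun ω (k : Fin n) => X k ω) inferInstance ≤ mΩ := hpm.comap_le
  have hXc : ∀ j, j < n →
      Measurable[MeasurableSpace.comap (fun ω (k : Fin n) => X k ω) inferInstance] (X j) := by
    intro j hj
    have h1 : Measurable[MeasurableSpace.comap (fun ω (k : Fin n) => X k ω) inferInstance]
        (fun ω (k : Fin n) => X k ω) := comap_measurable _
    exact (measurable_pi_apply (⟨j, hj⟩ : Fin n) : Measurable fun f : Fin n → ℝ => f ⟨j, hj⟩).comp h1
  have hHm : Measurable[MeasurableSpace.comap (fun ω (k : Fin n) => X k ω) inferInstance]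
      fun ω => ρ * ((L : ℝ)⁻¹ * ∑ k ∈ Finset.range L, X (n - L + k) ω) + C := by
    refine (((Finset.measurable_sum _ fun k hk => hXc _ ?_).const_mul _).const_mul _).add_const _
    rw [Finset.mem_range] at hk
    omega
  have hHi : Integrable (fun ω => ρ * ((L : ℝ)⁻¹ * ∑ k ∈ Finset.range L, X (n - L + k) ω) + C) P := by
    refine (((integrable_finsetSum _ fun k hk => hint _ ?_).const_mul _).const_mul _).add
      (integrable_const _)
    rw [Finset.mem_range] at hk
    omega
  have hH0 : ∀ ω, 0 ≤ ρ * ((L : ℝ)⁻¹ * ∑ k ∈ Finset.range L, X (n - L + k) ω) + C := fun ω => by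
    have : 0 ≤ ∑ k ∈ Finset.range L, X (n - L + k) ω := Finset.sum_nonneg fun k _ => hX0 _ _
    positivity
  have hYi : Integrable (fun ω => min (X n ω) M) P := (hint n le_rfl).inf (integrable_const M)
  refine condExp_ae_le_of_setIntegral_le hm hYi hHi hHm.stronglyMeasurable fun s hs => ?_
  obtain ⟨B, hB, rfl⟩ := MeasurableSpace.measurableSet_comap.1 hs
  have hsm : MeasurableSet ((fun ω (k : Fin n) => X k ω) ⁻¹' B) := hpm hB
  calc ∫ ω in (fun ω (k : Fin n) => X k ω) ⁻¹' B, min (X n ω) M ∂P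
      ≤ ∫ ω in (fun ω (k : Fin n) => X k ω) ⁻¹' B, X n ω ∂P :=
        setIntegral_mono hYi.integrableOn (hint n le_rfl).integrableOn fun ω => min_le_left _ _
    _ ≤ ∫ ω in (fun ω (k : Fin n) => X k ω) ⁻¹' B,
          (ρ * ((L : ℝ)⁻¹ * ∑ k ∈ Finset.range L, X (n - L + k) ω) + C) ∂P := by
        refine setIntegral_le_of_lintegral_indicator_le hsm (hX0 n) hH0 (hint n le_rfl) hHi ?_
        have key := hdrift (B.indicator fun _ => (1 : ℝ)) (measurable_const.indicator hB) fun y => by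
          by_cases hy : y ∈ B <;> simp [hy]
        have hind : ∀ ω, ((fun ω (k : Fin n) => X k ω) ⁻¹' B).indicator (fun _ => (1 : ℝ)) ω =
            B.indicator (fun _ => (1 : ℝ)) (fun k : Fin n => X k ω) := fun ω => rfl
        simp_rw [hind]
        exact key

/-- The engine along an abstract family `G` of sub-σ-algebras (monotone, `X k` is `G n`-measurable for `k < n`),
given the a.e. drift of the predictors of the truncated blocks `min (X n) M`, `L ≤ n < K`:
`E[ā 𝟙{ā > 4(C+1)/(1-ρ)}] ≤ M'(δ + (M² + L m)/K) + δ'` for `ā = K⁻¹ Σ_{j<K} X j`.  Doob decomposition of the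
truncated blocks, orthogonality of the increments (Chebyshev), Markov for the first `L` blocks and for the
overshoots `(X j - M)₊`, and the pointwise bound `ā 𝟙{ā > V₀} ≤ K⁻¹ Σ_j (X j - M')₊ + M' 𝟙{ā > V₀}`. -/
theorem engine_of_condExp_drift {Ω : Type*} {mΩ : MeasurableSpace Ω} (P : Measure Ω)
    [IsProbabilityMeasure P] (K L : ℕ) (X : ℕ → Ω → ℝ) (ρ C M δ M' δ' m : ℝ)
    (G : ℕ → MeasurableSpace Ω) (hGle : ∀ n, G n ≤ mΩ) (hGmono : Monotone G)
    (hXG : ∀ n k, k < n → Measurable[G n] (X k)) (hXm : ∀ j, Measurable (X j))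
    (hX0 : ∀ j ω, 0 ≤ X j ω) (hρ0 : 0 ≤ ρ) (hρ1 : ρ < 1) (hC : 0 ≤ C) (hL : 1 ≤ L) (hLK : L < K)
    (hM0 : 0 ≤ M) (hδ : 0 ≤ δ) (hM'0 : 0 ≤ M') (hδ' : 0 ≤ δ') (hm0 : 0 ≤ m)
    (hdrift : ∀ n, L ≤ n → n < K → P[fun ω => min (X n ω) M | G n] ≤ᵐ[P]
      fun ω => ρ * ((L : ℝ)⁻¹ * ∑ k ∈ Finset.range L, X (n - L + k) ω) + C)
    (hM : ∑ j ∈ Finset.range K, ∫⁻ ω, ENNReal.ofReal (X j ω - M) ∂P ≤ ENNReal.ofReal (K * δ))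
    (hM' : ∑ j ∈ Finset.range K, ∫⁻ ω, ENNReal.ofReal (X j ω - M') ∂P ≤ ENNReal.ofReal (K * δ'))
    (hm : ∑ j ∈ Finset.range L, ∫⁻ ω, ENNReal.ofReal (X j ω) ∂P ≤ ENNReal.ofReal (L * m)) :
    ∫⁻ ω, ENNReal.ofReal (Set.indicator {y : ℝ | 4 * (C + 1) / (1 - ρ) < y} (fun y => y)
        ((K : ℝ)⁻¹ * ∑ j ∈ Finset.range K, X j ω)) ∂P ≤
      ENNReal.ofReal (M' * (δ + (M ^ 2 + L * m) / K) + δ') := by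
  have hK0 : 0 < K := by omega
  have hK' : (0 : ℝ) < K := by exact_mod_cast hK0
  have omz : ∀ x : ℝ, ENNReal.ofReal (max x 0) = ENNReal.ofReal x := fun x => by
    rcases le_total x 0 with h | h
    · rw [max_eq_right h, ENNReal.ofReal_zero, ENNReal.ofReal_of_nonpos h]
    · rw [max_eq_left h]
  -- the predictors of the truncated blocks
  obtain ⟨π, hπ⟩ : ∃ π : ℕ → Ω → ℝ, ∀ n, π n = P[fun ω => min (X n ω) M|G n] := ⟨_, fun _ => rfl⟩
  have hYG : ∀ n n', n < n' → Measurable[G n'] fun ω => min (X n ω) M := fun n n' h =>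
    (measurable_id.min measurable_const).comp (hXG n' n h)
  have hYm : ∀ n, Measurable fun ω => min (X n ω) M := fun n => (hXm n).min measurable_const
  -- (1) the three exceptional events: the first `L` blocks (Markov) ...
  have hA : P {ω | (K : ℝ) < ∑ j ∈ Finset.range L, X j ω} ≤ ENNReal.ofReal (L * m / K) := by
    calc P {ω | (K : ℝ) < ∑ j ∈ Finset.range L, X j ω}
        ≤ (∫⁻ ω, ENNReal.ofReal (∑ j ∈ Finset.range L, X j ω) ∂P) / ENNReal.ofReal K :=
          meas_lt_le_lintegral_div P (Finset.measurable_sum _ fun j _ => hXm j).aemeasurable hK'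
      _ = (∑ j ∈ Finset.range L, ∫⁻ ω, ENNReal.ofReal (X j ω) ∂P) / ENNReal.ofReal K := by
          congr 1
          calc ∫⁻ ω, ENNReal.ofReal (∑ j ∈ Finset.range L, X j ω) ∂P
              = ∫⁻ ω, ∑ j ∈ Finset.range L, ENNReal.ofReal (X j ω) ∂P :=
                lintegral_congr fun ω => ENNReal.ofReal_sum_of_nonneg fun j _ => hX0 j ω
            _ = ∑ j ∈ Finset.range L, ∫⁻ ω, ENNReal.ofReal (X j ω) ∂P :=
                lintegral_finsetSum' _ fun j _ => (hXm j).ennreal_ofReal.aemeasurable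
      _ ≤ ENNReal.ofReal (L * m) / ENNReal.ofReal K := by gcongr
      _ = ENNReal.ofReal (L * m / K) := (ENNReal.ofReal_div_of_pos hK').symm
  -- ... the overshoots `(X j - M)₊` (Markov) ...
  have hB : P {ω | (K : ℝ) < ∑ j ∈ Finset.range K, max (X j ω - M) 0} ≤ ENNReal.ofReal δ := by
    calc P {ω | (K : ℝ) < ∑ j ∈ Finset.range K, max (X j ω - M) 0}
        ≤ (∫⁻ ω, ENNReal.ofReal (∑ j ∈ Finset.range K, max (X j ω - M) 0) ∂P) / ENNReal.ofReal K :=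
          meas_lt_le_lintegral_div P (Finset.measurable_sum _ fun j _ =>
            ((hXm j).sub_const M).max measurable_const).aemeasurable hK'
      _ = (∑ j ∈ Finset.range K, ∫⁻ ω, ENNReal.ofReal (X j ω - M) ∂P) / ENNReal.ofReal K := by
          congr 1
          calc ∫⁻ ω, ENNReal.ofReal (∑ j ∈ Finset.range K, max (X j ω - M) 0) ∂P
              = ∫⁻ ω, ∑ j ∈ Finset.range K, ENNReal.ofReal (X j ω - M) ∂P := by
                refine lintegral_congr fun ω => ?_
                rw [ENNReal.ofReal_sum_of_nonneg fun j _ => le_max_right _ _]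
                simp_rw [omz]
            _ = ∑ j ∈ Finset.range K, ∫⁻ ω, ENNReal.ofReal (X j ω - M) ∂P :=
                lintegral_finsetSum' _ fun j _ => ((hXm j).sub_const M).ennreal_ofReal.aemeasurable
      _ ≤ ENNReal.ofReal (K * δ) / ENNReal.ofReal K := by gcongr
      _ = ENNReal.ofReal δ := by
          rw [← ENNReal.ofReal_div_of_pos hK', mul_div_cancel_left₀ _ hK'.ne']
  -- ... and the martingale part of the truncated blocks (Chebyshev).
  have hS : P {ω | (K : ℝ) < ∑ n ∈ Finset.Ico L K, (min (X n ω) M - π n ω)} ≤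
      ENNReal.ofReal (M ^ 2 / K) := by
    have h1 := meas_sum_increments_le P G hGle hGmono (fun n ω => min (X n ω) M) hM0 hYm hYG
      (fun n ω => le_min (hX0 n ω) hM0) (fun n ω => min_le_right _ _) (Finset.Ico L K) hK'
    simp only [← hπ] at h1
    refine h1.trans (ENNReal.ofReal_le_ofReal ?_)
    rw [Nat.card_Ico]
    have hKL : ((K - L : ℕ) : ℝ) ≤ K := by exact_mod_cast Nat.sub_le K L
    calc ((K - L : ℕ) : ℝ) * M ^ 2 / K ^ 2 ≤ (K : ℝ) * M ^ 2 / K ^ 2 := by gcongr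
      _ = M ^ 2 / K := by field_simp
  -- (2) the drift, a.e. and summed
  have hae : ∀ᵐ ω ∂P, ∀ n ∈ Finset.Ico L K,
      π n ω ≤ ρ * ((L : ℝ)⁻¹ * ∑ k ∈ Finset.range L, X (n - L + k) ω) + C := by
    refine (Finset.eventually_all (Finset.Ico L K)).2 fun n hn => ?_
    rw [Finset.mem_Ico] at hn
    have h := hdrift n hn.1 hn.2
    rw [← hπ n] at h
    exact h
  -- (3) the pathwise inequality `(1 - ρ) T ≤ A + B + C K + S`
  have hineq : ∀ᵐ ω ∂P, (1 - ρ) * ∑ j ∈ Finset.range K, X j ω ≤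
      ∑ j ∈ Finset.range L, X j ω + ∑ j ∈ Finset.range K, max (X j ω - M) 0 + C * K +
        ∑ n ∈ Finset.Ico L K, (min (X n ω) M - π n ω) := by
    filter_upwards [hae] with ω hω
    have hsplit : ∑ j ∈ Finset.range K, X j ω =
        ∑ j ∈ Finset.range L, X j ω + ∑ n ∈ Finset.Ico L K, X n ω :=
      (Finset.sum_range_add_sum_Ico _ hLK.le).symm
    have hdec : ∀ n, X n ω = max (X n ω - M) 0 + π n ω + (min (X n ω) M - π n ω) := fun n => by
      rcases le_total (X n ω) M with h | h
      · rw [max_eq_right (by linarith), min_eq_left h]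
        ring
      · rw [max_eq_left (by linarith), min_eq_right h]
        ring
    have hIco : ∑ n ∈ Finset.Ico L K, X n ω = ∑ n ∈ Finset.Ico L K, max (X n ω - M) 0 +
        ∑ n ∈ Finset.Ico L K, π n ω + ∑ n ∈ Finset.Ico L K, (min (X n ω) M - π n ω) := by
      rw [← Finset.sum_add_distrib, ← Finset.sum_add_distrib]
      exact Finset.sum_congr rfl fun n _ => hdec n
    have hBsub : ∑ n ∈ Finset.Ico L K, max (X n ω - M) 0 ≤
        ∑ j ∈ Finset.range K, max (X j ω - M) 0 :=
      Finset.sum_le_sum_of_subset_of_nonneg (fun n hn => by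
        simp only [Finset.mem_Ico, Finset.mem_range] at hn ⊢
        exact hn.2) fun j _ _ => le_max_right _ _
    have hwin := sum_Ico_window_le (fun j => X j ω) (fun j => hX0 j ω) hL hLK.le
    have hKL : ((K - L : ℕ) : ℝ) ≤ K := by exact_mod_cast Nat.sub_le K L
    have hπsum : ∑ n ∈ Finset.Ico L K, π n ω ≤ ρ * ∑ j ∈ Finset.range K, X j ω + C * K := by
      calc ∑ n ∈ Finset.Ico L K, π n ω
          ≤ ∑ n ∈ Finset.Ico L K, (ρ * ((L : ℝ)⁻¹ * ∑ k ∈ Finset.range L, X (n - L + k) ω) + C) :=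
            Finset.sum_le_sum hω
        _ = ρ * ∑ n ∈ Finset.Ico L K, (L : ℝ)⁻¹ * ∑ k ∈ Finset.range L, X (n - L + k) ω +
              ((K - L : ℕ) : ℝ) * C := by
            rw [Finset.sum_add_distrib, ← Finset.mul_sum, Finset.sum_const, Nat.card_Ico, nsmul_eq_mul]
        _ ≤ ρ * ∑ j ∈ Finset.range K, X j ω + (K : ℝ) * C := by gcongr
        _ = ρ * ∑ j ∈ Finset.range K, X j ω + C * K := by ring
    linarith [hsplit, hIco, hBsub, hπsum]
  -- (4) the union bound
  have hprob : P {ω | 4 * (C + 1) / (1 - ρ) < (K : ℝ)⁻¹ * ∑ j ∈ Finset.range K, X j ω} ≤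
      ENNReal.ofReal (L * m / K) + ENNReal.ofReal δ + ENNReal.ofReal (M ^ 2 / K) := by
    calc P {ω | 4 * (C + 1) / (1 - ρ) < (K : ℝ)⁻¹ * ∑ j ∈ Finset.range K, X j ω}
        ≤ P ({ω | (K : ℝ) < ∑ j ∈ Finset.range L, X j ω} ∪
            {ω | (K : ℝ) < ∑ j ∈ Finset.range K, max (X j ω - M) 0} ∪
            {ω | (K : ℝ) < ∑ n ∈ Finset.Ico L K, (min (X n ω) M - π n ω)}) := by
          refine measure_mono_ae (ae_le_set.2 (measure_mono_null (fun ω hω => ?_) (ae_iff.1 hineq)))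
          simp only [Set.mem_sdiff, Set.mem_union, Set.mem_setOf_eq, not_or, not_lt] at hω ⊢
          obtain ⟨hV, ⟨hA', hB'⟩, hS'⟩ := hω
          intro hcon
          rcases lt_or_lt_or_lt_of_drift hρ1 hC hK' hcon hV with h | h | h <;> linarith
      _ ≤ P {ω | (K : ℝ) < ∑ j ∈ Finset.range L, X j ω} +
            P {ω | (K : ℝ) < ∑ j ∈ Finset.range K, max (X j ω - M) 0} +
            P {ω | (K : ℝ) < ∑ n ∈ Finset.Ico L K, (min (X n ω) M - π n ω)} :=
          (measure_union_le _ _).trans (add_le_add (measure_union_le _ _) le_rfl)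
      _ ≤ ENNReal.ofReal (L * m / K) + ENNReal.ofReal δ + ENNReal.ofReal (M ^ 2 / K) :=
          add_le_add (add_le_add hA hB) hS
  -- (5) conclusion: `ā 𝟙{ā > V₀} ≤ K⁻¹ Σ_j (X j - M')₊ + M' 𝟙{ā > V₀}`
  have hBint : ∫⁻ ω, ENNReal.ofReal ((K : ℝ)⁻¹ * ∑ j ∈ Finset.range K, max (X j ω - M') 0) ∂P ≤
      ENNReal.ofReal δ' := by
    have e : ∀ ω, ENNReal.ofReal ((K : ℝ)⁻¹ * ∑ j ∈ Finset.range K, max (X j ω - M') 0) =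
        ENNReal.ofReal ((K : ℝ)⁻¹) * ∑ j ∈ Finset.range K, ENNReal.ofReal (X j ω - M') := by
      intro ω
      rw [ENNReal.ofReal_mul (inv_nonneg.2 hK'.le),
        ENNReal.ofReal_sum_of_nonneg fun j _ => le_max_right _ _]
      simp_rw [omz]
    calc ∫⁻ ω, ENNReal.ofReal ((K : ℝ)⁻¹ * ∑ j ∈ Finset.range K, max (X j ω - M') 0) ∂P
        = ENNReal.ofReal ((K : ℝ)⁻¹) * ∑ j ∈ Finset.range K, ∫⁻ ω, ENNReal.ofReal (X j ω - M') ∂P := by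
          simp_rw [e]
          rw [lintegral_const_mul' _ _ ENNReal.ofReal_ne_top, lintegral_finsetSum' _ fun j _ =>
            ((hXm j).sub_const M').ennreal_ofReal.aemeasurable]
      _ ≤ ENNReal.ofReal ((K : ℝ)⁻¹) * ENNReal.ofReal (K * δ') := by gcongr
      _ = ENNReal.ofReal δ' := by
          rw [← ENNReal.ofReal_mul (inv_nonneg.2 hK'.le), ← mul_assoc, inv_mul_cancel₀ hK'.ne',
            one_mul]
  have hAB : ∀ ω, (K : ℝ)⁻¹ * ∑ j ∈ Finset.range K, X j ω ≤
      (K : ℝ)⁻¹ * ∑ j ∈ Finset.range K, max (X j ω - M') 0 + M' := by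
    intro ω
    have h1 : ∑ j ∈ Finset.range K, X j ω ≤ ∑ j ∈ Finset.range K, (max (X j ω - M') 0 + M') :=
      Finset.sum_le_sum fun j _ => by
        have := le_max_left (X j ω - M') 0
        linarith
    rw [Finset.sum_add_distrib, Finset.sum_const, Finset.card_range, nsmul_eq_mul] at h1
    calc (K : ℝ)⁻¹ * ∑ j ∈ Finset.range K, X j ω
        ≤ (K : ℝ)⁻¹ * (∑ j ∈ Finset.range K, max (X j ω - M') 0 + K * M') :=
          mul_le_mul_of_nonneg_left h1 (inv_nonneg.2 hK'.le)
      _ = (K : ℝ)⁻¹ * ∑ j ∈ Finset.range K, max (X j ω - M') 0 + M' := by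
          rw [mul_add, ← mul_assoc (K : ℝ)⁻¹ K M', inv_mul_cancel₀ hK'.ne', one_mul]
  have hfin := lintegral_indicator_le_of_meas_le P
    ((Finset.measurable_sum _ fun j _ => hXm j).const_mul (K : ℝ)⁻¹)
    (fun ω => mul_nonneg (inv_nonneg.2 hK'.le) (Finset.sum_nonneg fun j _ => le_max_right _ _))
    hM'0 hAB hBint hprob
  refine hfin.trans (le_of_eq ?_)
  have h1 : 0 ≤ L * m / K := by positivity
  have h2 : 0 ≤ M ^ 2 / K := by positivity
  rw [← ENNReal.ofReal_add h1 hδ, ← ENNReal.ofReal_add (add_nonneg h1 hδ) h2,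
    ← ENNReal.ofReal_mul hM'0, ← ENNReal.ofReal_add hδ' (by positivity)]
  congr 1
  ring

/-- **Engine (drift ⇒ LLN), registered stub `stub_driftLLNEngine` of line `Sketch` (crux `TransferActivityTails`,
stmt-AtomisticToContinuum-16624).**  For nonnegative measurable blocks `X_0, …, X_{K-1}` whose one-step predictor
obeys the INTEGRATED drift `E[X_{j+1} g(X_0..X_j)] ≤ E[(ρ · L⁻¹ Σ_{k<L} X_{j+1-L+k} + C) g(X_0..X_j)]` for all
measurable `[0,1]`-valued test functionals `g` of the history (`L ≤ j+1 < K`), with overshoot budgets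
`Σ_j E(X_j - M)₊ ≤ K δ`, `Σ_j E(X_j - M')₊ ≤ K δ'` and `Σ_{j<L} E X_j ≤ L m`, the empirical average
`ā = K⁻¹ Σ_{j<K} X_j` satisfies `E[ā 𝟙{ā > 4(C+1)/(1-ρ)}] ≤ M'(δ + (M² + L m)/K) + δ'`.
Proof: natural filtration `σ(X_{<n}) = comap (ω ↦ (X k ω)_{k<n})`, `condExp_trunc_ae_le`,
`engine_of_condExp_drift`. -/
theorem stub_driftLLNEngine :
    ∀ (Ω : Type) [MeasurableSpace Ω] (P : Measure Ω) [IsProbabilityMeasure P] (K L : ℕ) (X : ℕ → Ω → ℝ)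
    (ρ C M δ M' δ' m : ℝ),
    (∀ j, Measurable (X j)) → (∀ j ω, 0 ≤ X j ω) → 0 ≤ ρ → ρ < 1 → 0 ≤ C → 1 ≤ L → L < K →
    0 ≤ M → 0 ≤ δ → 0 ≤ M' → 0 ≤ δ' → 0 ≤ m →
    (∀ j : ℕ, L ≤ j + 1 → j + 1 < K → ∀ g : (Fin (j + 1) → ℝ) → ℝ, Measurable g → (∀ y, 0 ≤ g y ∧ g y ≤ 1) →
      ∫⁻ ω, ENNReal.ofReal (X (j + 1) ω * g (fun k => X k ω)) ∂P ≤
      ∫⁻ ω, ENNReal.ofReal ((ρ * ((L : ℝ)⁻¹ * ∑ k ∈ Finset.range L, X (j + 1 - L + k) ω) + C) *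
        g (fun k => X k ω)) ∂P) →
    (∑ j ∈ Finset.range K, ∫⁻ ω, ENNReal.ofReal (X j ω - M) ∂P ≤ ENNReal.ofReal (K * δ)) →
    (∑ j ∈ Finset.range K, ∫⁻ ω, ENNReal.ofReal (X j ω - M') ∂P ≤ ENNReal.ofReal (K * δ')) →
    (∑ j ∈ Finset.range L, ∫⁻ ω, ENNReal.ofReal (X j ω) ∂P ≤ ENNReal.ofReal (L * m)) →
    ∫⁻ ω, ENNReal.ofReal (Set.indicator {y : ℝ | 4 * (C + 1) / (1 - ρ) < y} (fun y => y)
        ((K : ℝ)⁻¹ * ∑ j ∈ Finset.range K, X j ω)) ∂P ≤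
      ENNReal.ofReal (M' * (δ + (M ^ 2 + L * m) / K) + δ') := by
  intro Ω _ P _ K L X ρ C M δ M' δ' m hXm hX0 hρ0 hρ1 hC hL hLK hM0 hδ hM'0 hδ' hm0 hdrift hM hM' hm
  -- the natural filtration `σ(X_0, …, X_{n-1})`
  obtain ⟨G, hG⟩ : ∃ G : ℕ → MeasurableSpace Ω,
      ∀ n, G n = MeasurableSpace.comap (fun ω (k : Fin n) => X k ω) inferInstance := ⟨_, fun _ => rfl⟩
  have hpm : ∀ n, Measurable fun ω (k : Fin n) => X k ω := fun n =>
    measurable_pi_lambda _ fun k => hXm k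
  have hGle : ∀ n, G n ≤ ‹MeasurableSpace Ω› := fun n => by
    rw [hG n]
    exact (hpm n).comap_le
  have hXG : ∀ n k, k < n → Measurable[G n] (X k) := fun n k hk => by
    rw [hG n]
    have h1 : Measurable[MeasurableSpace.comap (fun ω (k : Fin n) => X k ω) inferInstance]
        (fun ω (k : Fin n) => X k ω) := comap_measurable _
    exact (measurable_pi_apply (⟨k, hk⟩ : Fin n) : Measurable fun f : Fin n → ℝ => f ⟨k, hk⟩).comp h1
  have hGmono : Monotone G := by
    intro n n' h
    rw [hG n, hG n', MeasurableSpace.comap_process_pi fun k : Fin n => X k,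
      MeasurableSpace.comap_process_pi fun k : Fin n' => X k]
    exact iSup_le fun k => le_iSup_of_le (Fin.castLE h k) le_rfl
  have hXi : ∀ j < K, Integrable (X j) P := integrable_of_sum_lintegral_sub_le hXm hX0 hM
  refine engine_of_condExp_drift P K L X ρ C M δ M' δ' m G hGle hGmono hXG hXm hX0 hρ0 hρ1 hC hL hLK
    hM0 hδ hM'0 hδ' hm0 (fun n hLn hnK => ?_) hM hM' hm
  obtain ⟨j, rfl⟩ : ∃ j, n = j + 1 := ⟨n - 1, by omega⟩
  rw [hG]
  exact condExp_trunc_ae_le X hXm hX0 M hρ0 hC hLn (fun i hi => hXi i (by omega)) (hdrift j hLn hnK)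

end Summit.AtomisticToContinuum.HydrodynamicLimit.Theorems.TransferActivityTailsDriftLLNEngine

end
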